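import Mathlib.Topology.Algebra.ContinuousMonoidHom
import Mathlib.Topology.Algebra.Group.Quotient
import Mathlib.Algebra.Group.Subgroup.Pointwise
import Mathlib.GroupTheory.QuotientGroup.Basic
import Mathlib.Tactic.Group
import Literature.NumberTheory.Automorphic.JacquetModule
import HarnessLib

/-!
# Transport of rank-one structure data (Iwahori factorisation, dominance, exhaustion, Cartan decomposition with centre, shell disjointness,
# compact-open levels) along an isomorphism of topological groups (Platonov–Rapinchuk §5.1; Casselman 1995, Prop. 1.4.4, Thm. 4.4.6)

Topic `NumberTheory/Automorphic`; namespace `Literature.NumberTheory.Automorphic.StructureTransport`.  THEOREMS ONLY (no definition, no named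
fact, no instance, no notation, no `sorry`); pure group theory and topology.  Cell `hodgecm-mathlib`, F0∕P3 «U3-mult», N5 road (★
`UnitaryGroup.U3SquareIntegrableExponents` [Casselman1995, Thm. 4.4.6]), file (R5b-gen) of the GROUP∕MEASURE half (seat B-p04 (g31)).

THE POINT.  The structure inputs of the rank-one Casselman criterion (★ `Representation.isSquareIntegrableModCenter_of_heckeRay_spectrum` ∕
`norm_sq_mul_lt_one_of_isSquareIntegrableModCenter`, F0P3-p01's R4: the Iwahori factorisation `hfac`, unique `N`-components `hinj`, dominance
`haM`∕`haN`∕`haNbar`, normality `hKK₀`, exhaustion `hexh`, the Cartan decomposition `hcartan` with centre, shell disjointness `hdisj`, compact open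
levels with a neighbourhood basis `hKb`) are proved for `U(3)` on the ONE-PLACE MODEL `G′ = U(σ_w, Φ₃)(L_w)` over a valued field (R5a, R5c, ★
`exists_cartan_of_involution`), and consumed on the CM carrier `G = U(Φ₃)(L⁺_v)`; the two are isomorphic topological groups (★ `localNonsplitEquiv`).
This file transports each binder SHAPE along an arbitrary `e : G ≃ₜ* G′`, pulling subgroups back by `comap (e : G →* G′)` and elements by
`e.symm`; the sequel-free CM identifications `comap e T′ = T`, `comap e N′ = N`, `comap e Z′ = Z` are ★ `CMLocalNonsplitBorelTransport`.

* §1 sets: `coe_comap_eq_image_symm`, `image_symm_mul`; **`comap_factorization`** (`hfac′ ⇒ hfac` for the comaps, with the middle∕right factors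
  rewritten along given identifications `B′.comap e = B`, `C′.comap e = C`).
* §2 elements: `comap_hinj`, `comap_comm` (`haM`), `comap_conj_mem` (`haN`), `comap_inv_conj_mem_inf` (`haNbar`), `comap_conj_mem_of_mem`
  (`a^{±1} N a^{∓1} ⊆ N`), `comap_normal` (`hKK₀`), `comap_exhaustion` (`hexh`), `symm_mem_center_iff`, `center_le_comap`, **`comap_cartan`** (`hcartan`).
* §3 shells: `mem_image_conj_doubleCoset`, **`comap_pairwise_disjoint_image_mk`** (`hdisj` in `G ⧸ Z(G)` from `hdisj′` in `G′ ⧸ Z(G′)`).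
* §4 topology: `isOpen_coe_comap`, `isCompact_coe_comap`, `isClosed_coe_comap`, **`comap_nhds_basis`** (`hKb`).
* §5 (ED. 2) **`exists_iwahoriDatum_comap`** — a whole ★ `ParabolicTriple.IwahoriDatum` pulls back along `e` once `t′.M.comap e = t.M`, `t′.N.comap e = t.N`.

## References
* [PlatonovRapinchuk1994] V. Platonov, A. Rapinchuk, *Algebraic Groups and Number Theory* (1994), §5.1 (the one-place model at a non-split place).
* [Casselman1995] W. Casselman, *Introduction to the theory of admissible representations of `p`-adic reductive groups* (draft 1 May 1995),
  Prop. 1.4.4 p. 14, §1.5, Thm. 4.4.6 p. 45.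
-/

set_option autoImplicit false

open scoped Pointwise

namespace Literature.NumberTheory.Automorphic

namespace StructureTransport

variable {G G' : Type*} [Group G] [Group G'] [TopologicalSpace G] [TopologicalSpace G'] (e : G ≃ₜ* G')

/-! ## §1 Sets: comaps are `e⁻¹`-images; factorisations transport -/

/-- `↑(S′.comap e) = e.symm '' S′`. [cite: PlatonovRapinchuk1994, §5.1] -/
theorem coe_comap_eq_image_symm (S' : Subgroup G') :
    ((S'.comap (e : G →* G') : Subgroup G) : Set G) = e.symm '' (S' : Set G') := by
  ext x
  simp only [Subgroup.coe_comap, Set.mem_preimage, MonoidHom.coe_coe, SetLike.mem_coe, Set.mem_image]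
  constructor
  · intro hx; exact ⟨e x, hx, e.symm_apply_apply x⟩
  · rintro ⟨y, hy, rfl⟩; simpa using hy

/-- `e.symm` respects pointwise products of sets. [cite: PlatonovRapinchuk1994, §5.1] -/
theorem image_symm_mul (S T : Set G') : e.symm '' (S * T) = e.symm '' S * e.symm '' T :=
  Set.image_mul (e.symm : G' ≃* G)

/-- **Transport of an Iwahori factorisation**: `K′ = (K′ ∩ A′)(K′ ∩ B′)(K′ ∩ C′)` (as sets in `G′`) gives, for `K = K′.comap e`, `A = A′.comap e` and
ANY subgroups `B, C ≤ G` identified with the comaps (`B′.comap e = B`, `C′.comap e = C` — e.g. the CM torus and radical, ★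
`comap_localNonsplitEquiv_torusU` ∕ `comap_localNonsplitEquiv_unipotentU`): `K = (K ∩ A)(K ∩ B)(K ∩ C)` — the `hfac` binder of the rank-one
criterion. [cite: Casselman1995, Prop. 1.4.4 p. 14] [cite: PlatonovRapinchuk1994, §5.1] -/
theorem comap_factorization {K' A' B' C' : Subgroup G'} {B C : Subgroup G}
    (hfac' : (K' : Set G') = ((K' ⊓ A' : Subgroup G') : Set G') * ((K' ⊓ B' : Subgroup G') : Set G') * ((K' ⊓ C' : Subgroup G') : Set G'))
    (hB : B'.comap (e : G →* G') = B) (hC : C'.comap (e : G →* G') = C) :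
    ((K'.comap (e : G →* G') : Subgroup G) : Set G) =
      ((K'.comap (e : G →* G') ⊓ A'.comap (e : G →* G') : Subgroup G) : Set G) *
        ((K'.comap (e : G →* G') ⊓ B : Subgroup G) : Set G) * ((K'.comap (e : G →* G') ⊓ C : Subgroup G) : Set G) := by
  subst hB hC
  rw [← Subgroup.comap_inf, ← Subgroup.comap_inf, ← Subgroup.comap_inf, coe_comap_eq_image_symm, coe_comap_eq_image_symm,
    coe_comap_eq_image_symm, coe_comap_eq_image_symm, hfac', image_symm_mul, image_symm_mul]

/-! ## §2 Elements: uniqueness, dominance, normality, exhaustion, centre, Cartan -/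

/-- **Transport of the uniqueness of `C`-components** in `A′·B′·C′` (the `hinj` binder). [cite: Casselman1995, Prop. 1.4.4 p. 14] -/
theorem comap_hinj {A' B' C' : Subgroup G'}
    (hinj' : ∀ nb ∈ A', ∀ m ∈ B', ∀ n ∈ C', ∀ nb' ∈ A', ∀ m' ∈ B', ∀ n' ∈ C', nb * m * n = nb' * m' * n' → n = n') :
    ∀ nb ∈ A'.comap (e : G →* G'), ∀ m ∈ B'.comap (e : G →* G'), ∀ n ∈ C'.comap (e : G →* G'),
      ∀ nb' ∈ A'.comap (e : G →* G'), ∀ m' ∈ B'.comap (e : G →* G'), ∀ n' ∈ C'.comap (e : G →* G'),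
        nb * m * n = nb' * m' * n' → n = n' := by
  intro nb hnb m hm n hn nb' hnb' m' hm' n' hn' h
  apply e.injective
  refine hinj' _ hnb _ hm _ hn _ hnb' _ hm' _ hn' ?_
  simpa [map_mul] using congrArg e h

/-- **Transport of `[a, K ∩ B] = 1`** (the `haM` binder). [cite: Casselman1995, Prop. 1.4.4 p. 14] -/
theorem comap_comm {K' B' : Subgroup G'} {a' : G'} (h : ∀ m ∈ K' ⊓ B', m * a' = a' * m) :
    ∀ m ∈ K'.comap (e : G →* G') ⊓ B'.comap (e : G →* G'), m * e.symm a' = e.symm a' * m := by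
  intro m hm
  apply e.injective
  rw [map_mul, map_mul, ContinuousMulEquiv.apply_symm_apply]
  rw [← Subgroup.comap_inf] at hm
  exact h _ hm

/-- **Transport of `a (K ∩ C) a⁻¹ ⊆ K`** (the `haN` binder). [cite: Casselman1995, Prop. 1.4.4 p. 14] -/
theorem comap_conj_mem {K' C' : Subgroup G'} {a' : G'} (h : ∀ x ∈ K' ⊓ C', a' * x * a'⁻¹ ∈ K') :
    ∀ x ∈ K'.comap (e : G →* G') ⊓ C'.comap (e : G →* G'), e.symm a' * x * (e.symm a')⁻¹ ∈ K'.comap (e : G →* G') := by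
  intro x hx
  rw [← Subgroup.comap_inf] at hx
  rw [Subgroup.mem_comap, MonoidHom.coe_coe, map_mul, map_mul, map_inv, ContinuousMulEquiv.apply_symm_apply]
  exact h _ hx

/-- **Transport of `a⁻¹ (K ∩ A) a ⊆ K ∩ A`** (the `haNbar` binder). [cite: Casselman1995, Prop. 1.4.4 p. 14] -/
theorem comap_inv_conj_mem_inf {K' A' : Subgroup G'} {a' : G'} (h : ∀ x ∈ K' ⊓ A', a'⁻¹ * x * a' ∈ K' ⊓ A') :
    ∀ x ∈ K'.comap (e : G →* G') ⊓ A'.comap (e : G →* G'),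
      (e.symm a')⁻¹ * x * e.symm a' ∈ K'.comap (e : G →* G') ⊓ A'.comap (e : G →* G') := by
  intro x hx
  rw [← Subgroup.comap_inf] at hx ⊢
  rw [Subgroup.mem_comap, MonoidHom.coe_coe, map_mul, map_mul, map_inv, ContinuousMulEquiv.apply_symm_apply]
  exact h _ hx

/-- **Transport of `a⁻¹ C a ⊆ C`** (the radical is normalised). [cite: Casselman1995, Prop. 1.4.3] -/
theorem comap_inv_conj_mem_of_mem {C' : Subgroup G'} {a' : G'} (h : ∀ n ∈ C', a'⁻¹ * n * a' ∈ C') :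
    ∀ n ∈ C'.comap (e : G →* G'), (e.symm a')⁻¹ * n * e.symm a' ∈ C'.comap (e : G →* G') := by
  intro n hn
  rw [Subgroup.mem_comap, MonoidHom.coe_coe, map_mul, map_mul, map_inv, ContinuousMulEquiv.apply_symm_apply]
  exact h _ hn

/-- **Transport of `a C a⁻¹ ⊆ C`**. [cite: Casselman1995, Prop. 1.4.3] -/
theorem comap_conj_inv_mem_of_mem {C' : Subgroup G'} {a' : G'} (h : ∀ n ∈ C', a' * n * a'⁻¹ ∈ C') :
    ∀ n ∈ C'.comap (e : G →* G'), e.symm a' * n * (e.symm a')⁻¹ ∈ C'.comap (e : G →* G') := by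
  intro n hn
  rw [Subgroup.mem_comap, MonoidHom.coe_coe, map_mul, map_mul, map_inv, ContinuousMulEquiv.apply_symm_apply]
  exact h _ hn

/-- **Transport of normality `k⁻¹ K k ⊆ K` for `k ∈ K₀`** (the `hKK₀` binder). [cite: Casselman1995, Prop. 1.4.4 p. 14] -/
theorem comap_normal {K₀' K' : Subgroup G'} (h : ∀ k ∈ K₀', ∀ κ ∈ K', k⁻¹ * κ * k ∈ K') :
    ∀ k ∈ K₀'.comap (e : G →* G'), ∀ κ ∈ K'.comap (e : G →* G'), k⁻¹ * κ * k ∈ K'.comap (e : G →* G') := by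
  intro k hk κ hκ
  rw [Subgroup.mem_comap, MonoidHom.coe_coe, map_mul, map_mul, map_inv]
  exact h _ hk _ hκ

/-- **Transport of the exhaustion `⋃ₘ a⁻ᵐ K aᵐ ⊇ C`** in the monotone form of the Hecke-ray files (the `hexh` binder):
`∀ n ∈ C, ∃ m, ∀ m′ ≥ m, a^{m′} n a^{-m′} ∈ K`. [cite: Casselman1995, Prop. 4.1.6] -/
theorem comap_exhaustion {K' C' : Subgroup G'} {a' : G'} (h : ∀ n ∈ C', ∃ m : ℕ, ∀ m' ≥ m, a' ^ m' * n * (a' ^ m')⁻¹ ∈ K') :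
    ∀ n ∈ C'.comap (e : G →* G'), ∃ m : ℕ, ∀ m' ≥ m, e.symm a' ^ m' * n * (e.symm a' ^ m')⁻¹ ∈ K'.comap (e : G →* G') := by
  intro n hn
  obtain ⟨m, hm⟩ := h _ hn
  refine ⟨m, fun m' hm' => ?_⟩
  rw [Subgroup.mem_comap, MonoidHom.coe_coe, map_mul, map_mul, map_inv, map_pow, ContinuousMulEquiv.apply_symm_apply]
  exact hm m' hm'

/-- `e.symm z ∈ Z(G) ↔ z ∈ Z(G′)`. [cite: PlatonovRapinchuk1994, §5.1] -/
theorem symm_mem_center_iff (z : G') : e.symm z ∈ Subgroup.center G ↔ z ∈ Subgroup.center G' := by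
  rw [Subgroup.mem_center_iff, Subgroup.mem_center_iff]
  constructor
  · intro h g
    apply e.symm.injective
    rw [map_mul, map_mul]
    exact h _
  · intro h g
    apply e.injective
    rw [map_mul, map_mul, ContinuousMulEquiv.apply_symm_apply]
    exact h _

/-- `g ∈ Z(G) ↔ e g ∈ Z(G′)`. [cite: PlatonovRapinchuk1994, §5.1] -/
theorem mem_center_iff_apply_mem_center (g : G) : g ∈ Subgroup.center G ↔ e g ∈ Subgroup.center G' := by
  rw [← symm_mem_center_iff e (e g), ContinuousMulEquiv.symm_apply_apply]

/-- **Transport of `Z(G′) ≤ K₀′`**: `Z(G) ≤ K₀′.comap e`. [cite: PlatonovRapinchuk1994, §5.1] -/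
theorem center_le_comap {K₀' : Subgroup G'} (h : Subgroup.center G' ≤ K₀') : Subgroup.center G ≤ K₀'.comap (e : G →* G') :=
  fun g hg => h ((mem_center_iff_apply_mem_center e g).1 hg)

/-- **Transport of the Cartan decomposition `G′ = ⋃ₘ K₀′ a′ᵐ K₀′ Z(G′)`** (★ `exists_cartan_of_involution`'s shape = the `hcartan` binder):
`∀ g, ∃ k₁ ∈ K₀, ∃ k₂ ∈ K₀, ∃ m, ∃ z ∈ Z(G), g = k₁ aᵐ k₂ z` with `K₀ = K₀′.comap e`, `a = e.symm a′`. [cite: Casselman1995, Thm. 4.4.6 p. 45]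
[cite: PlatonovRapinchuk1994, §5.1] -/
theorem comap_cartan {K₀' : Subgroup G'} {a' : G'}
    (h : ∀ g' : G', ∃ k₁ ∈ K₀', ∃ k₂ ∈ K₀', ∃ m : ℕ, ∃ z ∈ Subgroup.center G', g' = k₁ * a' ^ m * k₂ * z) :
    ∀ g : G, ∃ k₁ ∈ K₀'.comap (e : G →* G'), ∃ k₂ ∈ K₀'.comap (e : G →* G'), ∃ m : ℕ, ∃ z ∈ Subgroup.center G,
      g = k₁ * e.symm a' ^ m * k₂ * z := by
  intro g
  obtain ⟨k₁, hk₁, k₂, hk₂, m, z, hz, hg⟩ := h (e g)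
  refine ⟨e.symm k₁, by simpa using hk₁, e.symm k₂, by simpa using hk₂, m, e.symm z, (symm_mem_center_iff e z).2 hz, ?_⟩
  apply e.injective
  rw [hg, map_mul, map_mul, map_mul, map_pow, ContinuousMulEquiv.apply_symm_apply, ContinuousMulEquiv.apply_symm_apply,
    ContinuousMulEquiv.apply_symm_apply, ContinuousMulEquiv.apply_symm_apply]

/-- `e.symm a′ ∈ B′.comap e` for `a′ ∈ B′` (the ray element lies in the transported Levi). [cite: PlatonovRapinchuk1994, §5.1] -/
theorem symm_mem_comap {B' : Subgroup G'} {a' : G'} (ha' : a' ∈ B') : e.symm a' ∈ B'.comap (e : G →* G') := by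
  simpa using ha'

/-! ## §3 Shells: disjointness in `G ⧸ Z(G)` transports -/

/-- `e` maps the shell `K {aᵐ} K` (`K = K′.comap e`, `a = e.symm a′`) into `K′ {a′ᵐ} K′`. [cite: Casselman1995, §1.5] -/
theorem apply_mem_doubleCoset_of_mem {K' : Subgroup G'} {a' : G'} {m : ℕ} {x : G}
    (hx : x ∈ ((K'.comap (e : G →* G') : Subgroup G) : Set G) * {e.symm a' ^ m} * ((K'.comap (e : G →* G') : Subgroup G) : Set G)) :
    e x ∈ (K' : Set G') * {a' ^ m} * (K' : Set G') := by
  obtain ⟨y, hy, k₂, hk₂, rfl⟩ := Set.mem_mul.1 hx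
  obtain ⟨k₁, hk₁, s, hs, rfl⟩ := Set.mem_mul.1 hy
  rw [Set.mem_singleton_iff] at hs
  subst hs
  refine Set.mem_mul.2 ⟨e k₁ * a' ^ m, Set.mem_mul.2 ⟨e k₁, hk₁, a' ^ m, Set.mem_singleton _, rfl⟩, e k₂, hk₂, ?_⟩
  rw [map_mul, map_mul, map_pow, ContinuousMulEquiv.apply_symm_apply]

/-- **Transport of shell disjointness modulo the centre** (the `hdisj` binder of ★ `norm_sq_mul_lt_one_of_isSquareIntegrableModCenter`): if the
images of the shells `K′ {a′ᵐ} K′` in `G′ ⧸ Z(G′)` are pairwise disjoint, so are the images of `K {aᵐ} K` in `G ⧸ Z(G)` (`K = K′.comap e`,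
`a = e.symm a′`; `x⁻¹ y ∈ Z(G) ↔ (e x)⁻¹ (e y) ∈ Z(G′)`). [cite: Casselman1995, Thm. 4.4.6 p. 45] [cite: PlatonovRapinchuk1994, §5.1] -/
theorem comap_pairwise_disjoint_image_mk {K' : Subgroup G'} {a' : G'}
    (h : Pairwise fun m m' : ℕ =>
      Disjoint ((QuotientGroup.mk : G' → G' ⧸ Subgroup.center G') '' ((K' : Set G') * {a' ^ m} * (K' : Set G')))
        ((QuotientGroup.mk : G' → G' ⧸ Subgroup.center G') '' ((K' : Set G') * {a' ^ m'} * (K' : Set G')))) :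
    Pairwise fun m m' : ℕ =>
      Disjoint ((QuotientGroup.mk : G → G ⧸ Subgroup.center G) ''
          (((K'.comap (e : G →* G') : Subgroup G) : Set G) * {e.symm a' ^ m} * ((K'.comap (e : G →* G') : Subgroup G) : Set G)))
        ((QuotientGroup.mk : G → G ⧸ Subgroup.center G) ''
          (((K'.comap (e : G →* G') : Subgroup G) : Set G) * {e.symm a' ^ m'} * ((K'.comap (e : G →* G') : Subgroup G) : Set G))) := by
  intro m m' hne
  rw [Set.disjoint_left]
  rintro _ ⟨x, hx, rfl⟩ ⟨y, hy, hxy⟩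
  have hxy' : y⁻¹ * x ∈ Subgroup.center G := QuotientGroup.eq.1 hxy
  have hq : ((e y : G') : G' ⧸ Subgroup.center G') = (e x : G' ⧸ Subgroup.center G') := by
    rw [QuotientGroup.eq, ← map_inv, ← map_mul]
    exact (mem_center_iff_apply_mem_center e _).1 hxy'
  exact Set.disjoint_left.1 (h hne) ⟨e x, apply_mem_doubleCoset_of_mem e hx, rfl⟩ ⟨e y, apply_mem_doubleCoset_of_mem e hy, hq⟩

/-! ## §4 Topology: compact open levels and the neighbourhood basis -/

/-- `K′.comap e` is open for `K′` open. [cite: PlatonovRapinchuk1994, §5.1] -/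
theorem isOpen_coe_comap {K' : Subgroup G'} (h : IsOpen (K' : Set G')) : IsOpen ((K'.comap (e : G →* G') : Subgroup G) : Set G) :=
  h.preimage e.continuous

/-- `K′.comap e` is closed for `K′` closed. [cite: PlatonovRapinchuk1994, §5.1] -/
theorem isClosed_coe_comap {K' : Subgroup G'} (h : IsClosed (K' : Set G')) : IsClosed ((K'.comap (e : G →* G') : Subgroup G) : Set G) :=
  h.preimage e.continuous

/-- `K′.comap e` is compact for `K′` compact. [cite: PlatonovRapinchuk1994, §5.1] -/
theorem isCompact_coe_comap {K' : Subgroup G'} (h : IsCompact (K' : Set G')) : IsCompact ((K'.comap (e : G →* G') : Subgroup G) : Set G) := by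
  rw [coe_comap_eq_image_symm]
  exact h.image e.symm.continuous

/-- **Transport of a neighbourhood basis of `1`** (the `hKb` binder): if `(K′ n)` shrinks to `1` in `G′`, then `((K′ n).comap e)` shrinks to `1` in `G`.
[cite: Casselman1995, Prop. 1.4.4 p. 14] [cite: PlatonovRapinchuk1994, §5.1] -/
theorem comap_nhds_basis {Kf' : ℕ → Subgroup G'} (h : ∀ U' ∈ nhds (1 : G'), ∃ n, (Kf' n : Set G') ⊆ U') :
    ∀ U ∈ nhds (1 : G), ∃ n, (((Kf' n).comap (e : G →* G') : Subgroup G) : Set G) ⊆ U := by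
  intro U hU
  have hc : ContinuousAt (fun y : G' => e.symm y) 1 := e.symm.continuous.continuousAt
  have h1 : e.symm (1 : G') = 1 := map_one e.symm
  have hU' : (fun y : G' => e.symm y) ⁻¹' U ∈ nhds (1 : G') := hc.preimage_mem_nhds (by rw [h1]; exact hU)
  obtain ⟨n, hn⟩ := h _ hU'
  refine ⟨n, fun x hx => ?_⟩
  have h2 : e x ∈ (fun y : G' => e.symm y) ⁻¹' U := hn hx
  simpa using h2

/-! ## §5 (ED. 2) Transport of a whole Iwahori datum -/

/-- `x ∈ (bKb⁻¹) ↔ b⁻¹ x b ∈ K` for Mathlib's `ConjAct` action (bookkeeping copy). [folklore] -/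
private theorem mem_conj_smul_iff'' {H : Type*} [Group H] (K : Subgroup H) (b x : H) :
    x ∈ ConjAct.toConjAct b • K ↔ b⁻¹ * x * b ∈ K := by
  rw [Subgroup.mem_pointwise_smul_iff_inv_smul_mem, ← map_inv, ConjAct.toConjAct_smul, inv_inv]

/-- **Transport of an Iwahori datum** (★ `ParabolicTriple.IwahoriDatum`): for parabolic triples `t` of `G` and `t′` of `G′` whose Levi and radical
correspond under `e` (`t′.M.comap e = t.M`, `t′.N.comap e = t.N` — for the CM one-place model ★ `comap_localNonsplitEquiv_torusU` ∕
`comap_localNonsplitEquiv_unipotentU`), every Iwahori datum `𝓘′` for `t′` (e.g. ★ `UnitaryGroup.iwahoriDatumU3`) pulls back to an Iwahori datum `𝓘`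
for `t` with `𝓘.Nbar = 𝓘′.Nbar.comap e`, `𝓘.a = e.symm 𝓘′.a`, `𝓘.K n = (𝓘′.K n).comap e` (levels, factorisation, neighbourhood basis and the
contraction `a⁻ⁱ(K_n ∩ N̄)aⁱ ≤ K_j` transported by §§1–4). [cite: Casselman1995, Prop. 1.4.4 p. 14] [cite: PlatonovRapinchuk1994, §5.1] -/
theorem exists_iwahoriDatum_comap (t : ParabolicTriple G) (t' : ParabolicTriple G')
    (hM : t'.M.comap (e : G →* G') = t.M) (hN : t'.N.comap (e : G →* G') = t.N) (𝓘' : t'.IwahoriDatum) :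
    ∃ 𝓘 : t.IwahoriDatum, 𝓘.Nbar = 𝓘'.Nbar.comap (e : G →* G') ∧ 𝓘.a = e.symm 𝓘'.a ∧
      ∀ n, 𝓘.K n = (𝓘'.K n).comap (e : G →* G') := by
  refine ⟨{ Nbar := 𝓘'.Nbar.comap (e : G →* G')
            a := e.symm 𝓘'.a
            a_mem := ?_
            a_comm := ?_
            K := fun n => (𝓘'.K n).comap (e : G →* G')
            isOpen_K := fun n => isOpen_coe_comap e (𝓘'.isOpen_K n)
            isCompact_K := fun n => isCompact_coe_comap e (𝓘'.isCompact_K n)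
            hasBasis_K := comap_nhds_basis e 𝓘'.hasBasis_K
            factorization := fun n => comap_factorization e (𝓘'.factorization n) hM hN
            exists_conj_inf_Nbar_le := ?_ }, rfl, rfl, fun n => rfl⟩
  · -- `e.symm a′ ∈ t.M`
    rw [← hM]
    exact symm_mem_comap e 𝓘'.a_mem
  · -- `a` commutes with `t.M`
    intro m hm
    rw [← hM] at hm
    apply e.injective
    rw [map_mul, map_mul, ContinuousMulEquiv.apply_symm_apply]
    exact 𝓘'.a_comm _ hm
  · -- the contraction `a⁻ⁱ (K_n ∩ N̄) aⁱ ≤ K_j`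
    intro n j
    obtain ⟨i, hi⟩ := 𝓘'.exists_conj_inf_Nbar_le n j
    refine ⟨i, fun x hx => ?_⟩
    rw [mem_conj_smul_iff'', inv_inv] at hx
    have hx' : e (e.symm 𝓘'.a ^ i * x * (e.symm 𝓘'.a ^ i)⁻¹) ∈ 𝓘'.K n ⊓ 𝓘'.Nbar := by
      have h := hx
      rw [← Subgroup.comap_inf] at h
      exact h
    rw [map_mul, map_mul, map_inv, map_pow, ContinuousMulEquiv.apply_symm_apply] at hx'
    have hmem : e x ∈ ConjAct.toConjAct (𝓘'.a ^ i)⁻¹ • (𝓘'.K n ⊓ 𝓘'.Nbar) := by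
      rw [mem_conj_smul_iff'', inv_inv]
      exact hx'
    exact hi hmem

end StructureTransport

end Literature.NumberTheory.Automorphic
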